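import Summits.AtomisticToContinuum.FouriersLaw.Theses.PorousMediumCorner
import Summits.AtomisticToContinuum.FouriersLaw.Theorems.EmbeddedDrudeMourreAbelOfSpectralDensity
import HarnessLib

/-!
# Line `spectral-trichotomy` — crux `PorousMediumCorner.AnchorAbelGreenKubo` (stmt-AtomisticToContinuum-9790)

Crux-strategist skeleton (seat planner-cstrat-stmt-AtomisticToContinuum-9790-r1-0, 2026-08-17). THIS LINE IS THE
DECOMPOSITION VEHICLE OF THE CRUX: its four registered stubs are, verbatim, the four children of the prepared
`route edit --split AnchorAbelGreenKubo` (children.json in this crux directory; the gate offers `--split` on a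
seat's final cycle only), and `AnchorAbelGreenKubo_of` is the PROVED glue (symmetrisation of the spectral measure +
the Poisson-kernel Abelian lemma `AbelOfSpectralDensity.abelOfSpectralDensity_proof`, landed for stmt-12598).

Seam: the frequency-`0` SPECTRAL TRICHOTOMY of the summed current autocorrelation `C(t)` of the infinite purely
quartic ("anchor") chain `U = μq⁴/4`, `V = r⁴/4` at `T = 1` — a finite even spectral measure `σ` at frequency `0`
fails Abelian Green–Kubo in exactly three ways: an atom at `0` (ballistic; S3), a rough / singular / infinite
density near `0` (anomalous; S2), zero density (insulator; S4). S1 is the infrastructure (provable now from the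
tree's general-chain pipeline).

* S1 `stub_anchorSpectralSetup`      — ∃ shift-invariant DLR `ρ` at `T = 1`, `ρ`-preserving `D`, absolutely
                                        convergent `C`, finite `σ` with `C(t) = ∫ cos(ωt) dσ` (Bochner).
* S2 `stub_anchorLowFrequencyWindow` — ∀ admissible EVEN representations: window `σ|(−δ,δ) = σ{0}·δ₀ + g dω`,
                                        `g` continuous `≥ 0` (limiting absorption at `0`, atom allowed).
* S3 `stub_anchorNoDrudeWeight`      — ∀ admissible representations: `σ{0} = 0` (Mazur; no hidden odd charge).
* S4 `stub_anchorPositiveDensity`    — ∀ admissible representations and window densities (no atom): `0 < g 0`.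
-/

noncomputable section

namespace Summit.AtomisticToContinuum.FouriersLaw.Cruxes.AnchorAbelGreenKubo.SpectralTrichotomy

open MeasureTheory Filter Set Topology
open scoped NNReal ENNReal

/-- **S1 (infrastructure; provable now).** Spectral set-up of the anchor at `T = 1`: a shift-invariant DLR state,
a preserving infinite-volume dynamics, absolutely convergent summed current autocorrelation, and a finite
spectral measure representing it as a cosine transform (tree pipeline: transfer-operator Markov state +
uniqueness + exponential mixing, Buttà–Marchioro dynamics for even quartic `U, V`, transport regularity from
mixing + `L²` locality, zero-wavenumber data + strong continuity + momentum reversal ⇒ positive type ⇒ cosine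
Bochner). [cite: ButtaMarchioro2016, §2 Thm 2.1] -/
theorem stub_anchorSpectralSetup :
    ∀ μ γ : ℝ, 0 < μ → ∃ (ρ : MeasureTheory.Measure Literature.MathematicalPhysics.KineticTheory.HeatConduction.ChainConfig) (D : Literature.MathematicalPhysics.KineticTheory.HeatConduction.InfiniteChainDynamics (Literature.MathematicalPhysics.KineticTheory.HeatConduction.OscillatorChain.mk (fun q => μ * q ^ 4 / 4) (fun r => r ^ 4 / 4) γ)), (Literature.MathematicalPhysics.KineticTheory.HeatConduction.OscillatorChain.mk (fun q => μ * q ^ 4 / 4) (fun r => r ^ 4 / 4) γ).IsChainGibbsMeasure 1 ρ ∧ (∀ x : ℤ, MeasureTheory.MeasurePreserving (fun σ : Literature.MathematicalPhysics.KineticTheory.HeatConduction.ChainConfig => fun i : ℤ => σ (i + x)) ρ ρ) ∧ D.PreservesMeasure ρ ∧ (∀ t : ℝ, D.HasAbsConvergentCorrelation ρ t) ∧ ∃ σ : MeasureTheory.Measure ℝ, MeasureTheory.IsFiniteMeasure σ ∧ ∀ t : ℝ, D.currentCorrelation ρ t = MeasureTheory.integral σ (fun ω : ℝ => Real.cos (ω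 * t)) := by
  sorry

/-- **S2 (crux; limiting absorption at frequency 0, atom allowed).** For every admissible EVEN spectral
representation of the anchor's current autocorrelation at `T = 1`, a low-frequency window on which
`σ = σ{0}·δ₀ + g dω` with `g` continuous and non-negative. [cite: CattaneoGrafHunziker2006, Thm 1.1] -/
theorem stub_anchorLowFrequencyWindow :
    ∀ μ γ : ℝ, 0 < μ → ∀ (ρ : MeasureTheory.Measure Literature.MathematicalPhysics.KineticTheory.HeatConduction.ChainConfig) (D : Literature.MathematicalPhysics.KineticTheory.HeatConduction.InfiniteChainDynamics (Literature.MathematicalPhysics.KineticTheory.HeatConduction.OscillatorChain.mk (fun q => μ * q ^ 4 / 4) (fun r => r ^ 4 / 4) γ)), (Literature.MathematicalPhysics.KineticTheory.HeatConduction.OscillatorChain.mk (fun q => μ * q ^ 4 / 4) (fun r => r ^ 4 / 4) γ).IsChainGibbsMeasure 1 ρ → (∀ x : ℤ, MeasureTheory.MeasurePreserving (fun σ : Literature.MathematicalPhysics.KineticTheory.HeatConduction.ChainConfig => fun i : ℤ => σ (i + x)) ρ ρ) → D.PreservesMeasure ρ → (∀ t : ℝ, D.HasAbsConvergentCorrelation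 ρ t) → ∀ σ : MeasureTheory.Measure ℝ, MeasureTheory.IsFiniteMeasure σ → MeasureTheory.Measure.map (fun ω : ℝ => -ω) σ = σ → (∀ t : ℝ, D.currentCorrelation ρ t = MeasureTheory.integral σ (fun ω : ℝ => Real.cos (ω * t))) → ∃ (δ : ℝ) (g : ℝ → ℝ), 0 < δ ∧ ContinuousOn g (Set.Ioo (-δ) δ) ∧ (∀ ω ∈ Set.Ioo (-δ) δ, 0 ≤ g ω) ∧ σ.restrict (Set.Ioo (-δ) δ) = σ {0} • MeasureTheory.Measure.dirac 0 + (MeasureTheory.volume.restrict (Set.Ioo (-δ) δ)).withDensity (fun ω => ENNReal.ofReal (g ω)) := by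
  sorry

/-- **S3 (crux; Mazur content).** For every admissible spectral representation: no atom at frequency `0`
(no flow-invariant `L²` class of `ℋ₀(ρ)`, odd under momentum reversal, overlaps the current).
[cite: Doyon2022, Thm 5.1] -/
theorem stub_anchorNoDrudeWeight :
    ∀ μ γ : ℝ, 0 < μ → ∀ (ρ : MeasureTheory.Measure Literature.MathematicalPhysics.KineticTheory.HeatConduction.ChainConfig) (D : Literature.MathematicalPhysics.KineticTheory.HeatConduction.InfiniteChainDynamics (Literature.MathematicalPhysics.KineticTheory.HeatConduction.OscillatorChain.mk (fun q => μ * q ^ 4 / 4) (fun r => r ^ 4 / 4) γ)), (Literature.MathematicalPhysics.KineticTheory.HeatConduction.OscillatorChain.mk (fun q => μ * q ^ 4 / 4) (fun r => r ^ 4 / 4) γ).IsChainGibbsMeasure 1 ρ → (∀ x : ℤ, MeasureTheory.MeasurePreserving (fun σ : Literature.MathematicalPhysics.KineticTheory.HeatConduction.ChainConfig => fun i : ℤ => σ (i + x)) ρ ρ) → D.PreservesMeasure ρ → (∀ t : ℝ, D.HasAbsConvergentCorrelation ρ t) → ∀ σ : MeasureTheory.Measure ℝ, MeasureTheory.IsFiniteMeasure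 σ → (∀ t : ℝ, D.currentCorrelation ρ t = MeasureTheory.integral σ (fun ω : ℝ => Real.cos (ω * t))) → σ {0} = 0 := by
  sorry

/-- **S4 (crux; not an insulator).** For every admissible spectral representation and every window on which `σ`
has a continuous non-negative density `g` (no atom): `0 < g 0`. [cite: BonettoLebowitzReyBellet2000, §7 eq. (37)] -/
theorem stub_anchorPositiveDensity :
    ∀ μ γ : ℝ, 0 < μ → ∀ (ρ : MeasureTheory.Measure Literature.MathematicalPhysics.KineticTheory.HeatConduction.ChainConfig) (D : Literature.MathematicalPhysics.KineticTheory.HeatConduction.InfiniteChainDynamics (Literature.MathematicalPhysics.KineticTheory.HeatConduction.OscillatorChain.mk (fun q => μ * q ^ 4 / 4) (fun r => r ^ 4 / 4) γ)), (Literature.MathematicalPhysics.KineticTheory.HeatConduction.OscillatorChain.mk (fun q => μ * q ^ 4 / 4) (fun r => r ^ 4 / 4) γ).IsChainGibbsMeasure 1 ρ → (∀ x : ℤ, MeasureTheory.MeasurePreserving (fun σ : Literature.MathematicalPhysics.KineticTheory.HeatConduction.ChainConfig => fun i : ℤ => σ (i + x)) ρ ρ) → D.PreservesMeasure ρ → (∀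 t : ℝ, D.HasAbsConvergentCorrelation ρ t) → ∀ (σ : MeasureTheory.Measure ℝ) (δ : ℝ) (g : ℝ → ℝ), MeasureTheory.IsFiniteMeasure σ → 0 < δ → (∀ t : ℝ, D.currentCorrelation ρ t = MeasureTheory.integral σ (fun ω : ℝ => Real.cos (ω * t))) → ContinuousOn g (Set.Ioo (-δ) δ) → (∀ ω ∈ Set.Ioo (-δ) δ, 0 ≤ g ω) → σ.restrict (Set.Ioo (-δ) δ) = (MeasureTheory.volume.restrict (Set.Ioo (-δ) δ)).withDensity (fun ω => ENNReal.ofReal (g ω)) → 0 < g 0 := by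
  sorry

/-! ### The glue (proved) -/

/-- **Symmetrisation of a spectral measure.** For a finite measure `σ` on `ℝ` the measure
`σ' := ½ (σ + σ ∘ (ω ↦ -ω)⁻¹)` is finite, even, and has the same cosine transform. [folklore] -/
theorem exists_even_measure_integral_cos_eq (σ : Measure ℝ) [IsFiniteMeasure σ] :
    ∃ σ' : Measure ℝ, IsFiniteMeasure σ' ∧ σ'.map (fun ω : ℝ => -ω) = σ' ∧
      ∀ t : ℝ, ∫ ω, Real.cos (ω * t) ∂σ' = ∫ ω, Real.cos (ω * t) ∂σ := by
  have hme : Measurable (fun ω : ℝ => -ω) := measurable_neg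
  have hemb : MeasurableEmbedding (fun ω : ℝ => -ω) := (Homeomorph.neg ℝ).measurableEmbedding
  have hinv : (fun ω : ℝ => -ω) ∘ (fun ω : ℝ => -ω) = id := by
    funext ω
    simp
  refine ⟨(2⁻¹ : ℝ≥0) • (σ + σ.map (fun ω : ℝ => -ω)), inferInstance, ?_, fun t => ?_⟩
  · rw [Measure.map_smul, Measure.map_add _ _ hme, Measure.map_map hme hme, hinv, Measure.map_id,
      add_comm]
  · have hint : ∀ μ : Measure ℝ, IsFiniteMeasure μ → Integrable (fun ω : ℝ => Real.cos (ω * t)) μ := by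
      intro μ _
      refine (integrable_const (1 : ℝ)).mono' (by fun_prop) (ae_of_all _ fun ω => ?_)
      rw [Real.norm_eq_abs]
      exact Real.abs_cos_le_one _
    rw [integral_smul_nnreal_measure, integral_add_measure (hint σ inferInstance)
      (hint _ inferInstance), hemb.integral_map]
    simp only [neg_mul, Real.cos_neg]
    rw [NNReal.smul_def, smul_eq_mul]
    push_cast
    ring

/-- **The Poisson-kernel Abelian lemma** in Literature vocabulary (the landed proof of item
stmt-AtomisticToContinuum-12598, `abelOfSpectralDensity_proof`, unfolded): a finite measure `σ` whose
restriction to `(−δ, δ)` has a continuous non-negative Lebesgue density `g` has Abel means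
`∫₀^∞ e^{−νt} (∫ cos(ωt) dσ) dt → π·g 0` as `ν ↓ 0`. [folklore] -/
theorem abel_of_spectralDensity (σ : Measure ℝ) (C : ℝ → ℝ) (δ : ℝ) (g : ℝ → ℝ)
    (hfin : IsFiniteMeasure σ) (hδ : 0 < δ) (hC : ∀ t : ℝ, C t = ∫ ω, Real.cos (ω * t) ∂σ)
    (hg : ContinuousOn g (Ioo (-δ) δ)) (hg0 : ∀ ω ∈ Ioo (-δ) δ, 0 ≤ g ω)
    (hres : σ.restrict (Ioo (-δ) δ) = (volume.restrict (Ioo (-δ) δ)).withDensity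
      (fun ω => ENNReal.ofReal (g ω))) :
    Tendsto (fun ν : ℝ => ∫ t in Ioi (0:ℝ), Real.exp (-(ν * t)) * C t) (𝓝[>] 0)
      (𝓝 (Real.pi * g 0)) := by
  have h := Summit.AtomisticToContinuum.FouriersLaw.Theorems.AbelOfSpectralDensity.abelOfSpectralDensity_proof
  unfold Summit.AtomisticToContinuum.FouriersLaw.Theses.EmbeddedDrudeMourre.AbelOfSpectralDensity at h
  exact h σ C δ g hfin hδ hC hg hg0 hres

/-- **`AnchorAbelGreenKubo_of` — the registered skeleton.** The crux
`Summit.AtomisticToContinuum.FouriersLaw.Theses.PorousMediumCorner.AnchorAbelGreenKubo` follows from the four declared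
stubs BY NAME and with NO further hypotheses: take the spectral set-up `(ρ, D, σ₀)` (S1); symmetrise `σ₀` to an even `σ`
with the same cosine transform; S2 gives the window `σ|(−δ,δ) = σ{0}·δ₀ + g dω`; S3 kills the atom; S4 gives `g 0 > 0`;
the Poisson-kernel Abelian lemma computes the Abel limit `π·g 0` of `∫₀^∞ e^{−νt} C(t) dt`; hence the crux with the same
`(ρ, D)` and `κ₀ = π·g 0`. Axiom closure `{propext, Classical.choice, Quot.sound} ∪ {sorryAx via the four open stubs}`.
[folklore] -/
theorem AnchorAbelGreenKubo_of :
    Summit.AtomisticToContinuum.FouriersLaw.Theses.PorousMediumCorner.AnchorAbelGreenKubo := by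
  intro μ γ hμ
  obtain ⟨ρ, D, hG, hS, hP, hA, σ₀, hfin₀, hC₀⟩ := stub_anchorSpectralSetup μ γ hμ
  haveI : IsFiniteMeasure σ₀ := hfin₀
  -- symmetrise the spectral measure: even, finite, same cosine transform
  obtain ⟨σ, hfin, heven, hcos⟩ := exists_even_measure_integral_cos_eq σ₀
  have hC : ∀ t : ℝ, D.currentCorrelation ρ t = ∫ ω, Real.cos (ω * t) ∂σ := fun t => by
    rw [hcos t]; exact hC₀ t
  -- S2: the low-frequency window of the even representation
  obtain ⟨δ, g, hδ, hg, hg0, hres⟩ := stub_anchorLowFrequencyWindow μ γ hμ ρ D hG hS hP hA σ hfin heven hC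
  -- S3: no Drude weight, the atom at frequency 0 vanishes
  have hatom : σ {0} = 0 := stub_anchorNoDrudeWeight μ γ hμ ρ D hG hS hP hA σ hfin hC
  rw [hatom, zero_smul, zero_add] at hres
  -- S4: not an insulator
  have hpos : 0 < g 0 := stub_anchorPositiveDensity μ γ hμ ρ D hG hS hP hA σ δ g hfin hδ hC hg hg0 hres
  -- the Abelian (Poisson-kernel) lemma computes the Abel limit
  have hlim := abel_of_spectralDensity σ (D.currentCorrelation ρ) δ g hfin hδ hC hg hg0 hres
  exact ⟨ρ, D, Real.pi * g 0, hG, hP, hA, by positivity, hlim⟩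

/- The same composition in hypothesis form (sorry-free, standard axioms) — `anchorAbelGreenKubo_of_subs :
S1 → S2 → S3 → S4 → AnchorAbelGreenKubo` with the four stub statements spelled out — is the landable glue file
`AnchorAbelGreenKuboSplit.lean` in this crux directory (commit ac2e26eac627; item evidence on stmt-9790). -/

end Summit.AtomisticToContinuum.FouriersLaw.Cruxes.AnchorAbelGreenKubo.SpectralTrichotomy

end
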